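import Mathlib.ModelTheory.Definability
import Mathlib.ModelTheory.Complexity
import HarnessLib

/-!
# Quasiminimal pregeometry structures are quasiminimal

Trunk `Literature/ModelTheory`, topic quasiminimality (Zilber's programme for `ℂ_exp`; used by
`Literature/NumberTheory/Transcendental/ZilberProofs.lean` on the way to Bays–Kirby 2018,
Theorem 1.5).

An (uncountable) `L`-structure `M` is *quasiminimal* if every subset of `M` definable with
parameters is countable or co-countable. Zilber's method for proving quasiminimality goes
through *quasiminimal pregeometry structures*: `M` carries a pregeometry `cl` such that

* (QM1) the pregeometry is determined by quantifier-free types,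
* (QM2) `M` is infinite dimensional,
* (QM3) (countable closure property) `cl A` is countable for finite `A`,
* (QM4) (uniqueness of the generic type) over countable closed sets `H`, all elements outside `H`
  have the same quantifier-free type,
* (QM5) (`ℵ₀`-homogeneity over closed sets and `∅`),

(Bays–Hart–Hyttinen–Kesälä–Kirby 2014, Def. 2.1 = Bays–Kirby 2018, Def. 6.1; *weakly* if QM2 is
dropped). This file defines these notions and **proves** the basic fact used at the very end
of Bays–Kirby's proof of their Theorem 1.5 / Corollary 11.7 ("`F` is in `𝒦(M_tr(K))` and hence is
quasiminimal", p. 38): an uncountable weakly quasiminimal pregeometry structure is quasiminimal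
(Bays–Hart–Hyttinen–Kesälä–Kirby 2014, Prop. 7.1, second part, first clause), via the
`ℵ₀`-homogeneity lemma (ibid. Lemma 2.2) and a back-and-forth (Karp) argument showing that
finite tuples with the same quantifier-free type have the same first-order type (ibid. §2, first
paragraph: "It will follow from our axioms that if finite tuples `ā` and `b̄` from a model
satisfy the same quantifier-free `L`-type then they satisfy the same complete type").

## Contents

* `Literature.IsPregeometry cl` — closure operator with exchange and finite character on `Set M`.
* `FirstOrder.Language.EqQFType L x y` — the tuples `x y : α → M` satisfy the same atomic
  (equivalently quantifier-free) `L`-formulas.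
* `FirstOrder.Language.realize_iff_of_isBackAndForth` — Karp's lemma for a back-and-forth family
  of pairs of finite tuples.
* `FirstOrder.Language.EqQFTypeOver L H f t t'` — "`qftp(H, t) = qftp(H', t')`" for a countable
  set `H` matched to `H' = f '' H` by `f` (all finite sub-tuples).
* `Literature.IsWeaklyQuasiminimalPregeometryStructure L M cl`, `Literature.ModelTheory.Quasiminimal.IsQuasiminimalPregeometryStructure`
  (BHHKK 2014 Def. 2.1; Bays–Kirby 2018 Def. 6.1).
* `Literature.ModelTheory.Quasiminimal.IsWeaklyQuasiminimalPregeometryStructure.exists_closureIso` — back-and-forth inside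
  countable closures; `….homogeneity` (BHHKK 2014 Lemma 2.2);
  `….realize_iff_of_eqQFType` (same quantifier-free type ⇒ same first-order type);
  `….countable_or_countable_compl` (BHHKK 2014 Prop. 7.1: quasiminimality) — all **proved**.

## Design

* "Enumerated such that `qftp(H) = qftp(H')`" (QM4, QM5) is rendered without infinitary types:
  a countable closed `H : Set M` together with a map `f : M → M` (the enumeration-matching
  bijection `H → H' := f '' H`) such that every finite tuple `σ` from `H` has the same
  quantifier-free type as `f ∘ σ`. Finite tuples are `Fin n → M`, extended by `Fin.snoc` and
  `Fin.append`, matching `FirstOrder.Language.BoundedFormula.Realize`.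
* Quantifier-free types are compared on *atomic* formulas (`BoundedFormula.IsAtomic`); this is
  equivalent to comparing all quantifier-free formulas (`EqQFType.realize_iff_of_isQF`).
* The language is not assumed countable and `M` not assumed uncountable in the definitions; the
  quasiminimality theorem assumes `Uncountable M` (for countable `M` it is vacuous anyway).
  **Warning for fact-vendors:** the cited definitions are for a *countable* language; a named
  fact taking `Is(Weakly)QuasiminimalPregeometryStructure` as a *hypothesis* (e.g. BHHKK 2014
  Thm 2.3) must add `Countable L.Symbols` to stay faithful.
* `EqQFType`, `EqQFTypeOver`, `IsBackAndForth`, `realize_iff_of_isBackAndForth` are deliberate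
  dot-notation extensions in Mathlib's namespace `FirstOrder.Language` (precedent:
  `FirstOrder.Language.IsQuasiminimal` in `ZilberField.lean`), so that one writes
  `L.EqQFType x y`.
* Mathlib has `FirstOrder.Language.PartialEquiv`/`IsExtensionPair` (back-and-forth between
  finitely generated substructures) but no pregeometries, quantifier-free types or Karp lemma
  for arbitrary tuples (`rg -i 'quasiminimal|pregeometry|qftp'` over Mathlib is empty).

## References

* M. Bays, B. Hart, T. Hyttinen, M. Kesälä, J. Kirby, *Quasiminimal structures and excellence*,
  Bull. London Math. Soc. 46 (2014) 155–163, arXiv:1210.2008: Def. 2.1, Lemma 2.2, Thm 2.3,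
  Prop. 7.1.
* M. Bays, J. Kirby, *Pseudo-exponential maps, variants, and quasiminimality*, Algebra & Number
  Theory 12 (2018) 493–549, arXiv:1512.04262: Def. 6.1, Prop. 6.5, Fact 6.4, Cor. 11.7.
* J. Kirby, *On quasiminimal excellent classes*, J. Symbolic Logic 75 (2010) 551–564.
-/

noncomputable section

open Set FirstOrder FirstOrder.Language

universe u v w

namespace Literature.ModelTheory.Quasiminimal

/-! ### Pregeometries -/

/-- A **pregeometry** (finitary matroid given by its closure operator) on a type `M`: a closure
operator `cl : Set M → Set M` which is extensive, monotone, idempotent, of finite character and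
satisfies the Steinitz exchange law (Bays–Kirby 2018 §4.2; Kirby, *An invitation to model theory*
(2019), Def. p. 167). [folklore] -/
structure IsPregeometry {M : Type*} (cl : Set M → Set M) : Prop where
  /-- `A ⊆ cl A`. -/
  subset_cl : ∀ A : Set M, A ⊆ cl A
  /-- Monotonicity. -/
  mono : ∀ ⦃A B : Set M⦄, A ⊆ B → cl A ⊆ cl B
  /-- Idempotence. -/
  cl_cl : ∀ A : Set M, cl (cl A) = cl A
  /-- Finite character: membership in `cl A` is witnessed by a finite subset of `A`. -/
  finite_character : ∀ ⦃A : Set M⦄ ⦃a : M⦄, a ∈ cl A → ∃ A₀ ⊆ A, A₀.Finite ∧ a ∈ cl A₀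
  /-- Exchange: if `a ∈ cl (A ∪ {b}) ∖ cl A` then `b ∈ cl (A ∪ {a})`. -/
  exchange : ∀ ⦃A : Set M⦄ ⦃a b : M⦄, a ∈ cl (insert b A) → a ∉ cl A → b ∈ cl (insert a A)

namespace IsPregeometry

variable {M : Type*} {cl : Set M → Set M}

/-- Closed sets absorb closures of their subsets. [folklore] -/
theorem cl_subset_of_subset (h : IsPregeometry cl) {A C : Set M} (hAC : A ⊆ C) (hC : cl C = C) :
    cl A ⊆ C :=
  (h.mono hAC).trans hC.subset

/-- In a pregeometry with countable closures of finite sets, closures of countable sets are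
countable (finite character). [folklore] -/
theorem countable_cl (h : IsPregeometry cl) (hccp : ∀ A : Set M, A.Finite → (cl A).Countable)
    {A : Set M} (hA : A.Countable) : (cl A).Countable := by
  have hsub : cl A ⊆ ⋃ t ∈ {t : Set M | t.Finite ∧ t ⊆ A}, cl t := by
    intro a ha
    obtain ⟨A₀, hA₀A, hfin, ha₀⟩ := h.finite_character ha
    exact Set.mem_biUnion (x := A₀) ⟨hfin, hA₀A⟩ ha₀
  exact ((countable_setOf_finite_subset hA).biUnion fun t ht => hccp t ht.1).mono hsub

/-- In an uncountable pregeometry with countable closures of finite sets there are points outside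
the closure of any countable set. [folklore] -/
theorem exists_notMem_cl [Uncountable M] (h : IsPregeometry cl)
    (hccp : ∀ A : Set M, A.Finite → (cl A).Countable) {A : Set M} (hA : A.Countable) :
    ∃ a, a ∉ cl A := by
  by_contra! hcon
  have : (Set.univ : Set M).Countable := (h.countable_cl hccp hA).mono fun a _ => hcon a
  exact not_countable_univ this

end IsPregeometry

end Literature.ModelTheory.Quasiminimal

/-! ### Quantifier-free types of tuples -/

namespace FirstOrder.Language

variable (L : Language.{u, v}) {M : Type w} [L.Structure M]
variable {α β : Type*}

/-- Two tuples `x y : α → M` in an `L`-structure **have the same quantifier-free type**,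
`qftp(x) = qftp(y)`, if they satisfy the same atomic `L`-formulas (equivalently the same
quantifier-free formulas, `EqQFType.realize_iff_of_isQF`). A deliberate dot-notation extension in
Mathlib's namespace `FirstOrder.Language`. [folklore] -/
def EqQFType (x y : α → M) : Prop :=
  ∀ φ : L.Formula α, BoundedFormula.IsAtomic φ → (φ.Realize x ↔ φ.Realize y)

variable {L}

namespace EqQFType

/-- Reflexivity of `qftp` equality. [folklore] -/
protected theorem refl (x : α → M) : L.EqQFType x x := fun _ _ => Iff.rfl

/-- Symmetry of `qftp` equality. [folklore] -/
protected theorem symm {x y : α → M} (h : L.EqQFType x y) : L.EqQFType y x :=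
  fun φ hφ => (h φ hφ).symm

/-- Transitivity of `qftp` equality. [folklore] -/
protected theorem trans {x y z : α → M} (h₁ : L.EqQFType x y) (h₂ : L.EqQFType y z) :
    L.EqQFType x z :=
  fun φ hφ => (h₁ φ hφ).trans (h₂ φ hφ)

/-- Sub-tuples (and re-indexings) of tuples with the same quantifier-free type have the same
quantifier-free type. [folklore] -/
theorem comp {x y : α → M} (h : L.EqQFType x y) (g : β → α) : L.EqQFType (x ∘ g) (y ∘ g) := by
  intro φ hφ
  have := h (φ.relabel g) (by
    change BoundedFormula.IsAtomic (BoundedFormula.relabel (Sum.inl ∘ g) φ)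
    exact hφ.relabel _)
  simpa only [Formula.realize_relabel] using this

/-- Transport of `qftp` equality along pointwise equalities of tuples. [folklore] -/
theorem congr {x y x' y' : α → M} (h : L.EqQFType x y) (hx : x = x') (hy : y = y') :
    L.EqQFType x' y' := by
  subst hx hy
  exact h

/-- Tuples with the same quantifier-free type satisfy the same equalities between coordinates.
[folklore] -/
theorem apply_eq_iff {x y : α → M} (h : L.EqQFType x y) (i j : α) : x i = x j ↔ y i = y j := by
  have := h (Term.equal (var i) (var j)) (by
    change BoundedFormula.IsAtomic (Term.bdEqual _ _)
    exact BoundedFormula.IsAtomic.equal _ _)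
  simpa only [Formula.realize_equal, Term.realize_var] using this

/-- Tuples with the same quantifier-free type satisfy the same quantifier-free formulas.
[folklore] -/
theorem realize_iff_of_isQF {x y : α → M} (h : L.EqQFType x y) {φ : L.Formula α}
    (hφ : BoundedFormula.IsQF φ) : φ.Realize x ↔ φ.Realize y := by
  induction hφ with
  | falsum => exact Iff.rfl
  | of_isAtomic ha => exact h _ ha
  | imp _ _ ih₁ ih₂ =>
    change BoundedFormula.Realize _ x default → BoundedFormula.Realize _ x default ↔
      (BoundedFormula.Realize _ y default → BoundedFormula.Realize _ y default)
    exact imp_congr ih₁ ih₂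

/-- On an empty index type all tuples have the same quantifier-free type. [folklore] -/
theorem of_isEmpty [IsEmpty α] (x y : α → M) : L.EqQFType x y := by
  rw [Subsingleton.elim x y]
  exact EqQFType.refl y

/-- `qftp` equality of bounded-variable valuations: from equality of the quantifier-free types of
the concatenated tuples `Fin.append v xs`, `Fin.append v' ys` to agreement on atomic bounded
formulas. [folklore] -/
theorem realize_bd_iff {k n : ℕ} {v v' : Fin k → M} {xs ys : Fin n → M}
    (h : L.EqQFType (Fin.append v xs) (Fin.append v' ys)) {φ : L.BoundedFormula (Fin k) n}
    (hφ : φ.IsAtomic) : φ.Realize v xs ↔ φ.Realize v' ys := by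
  have key : ∀ (w : Fin k → M) (zs : Fin n → M),
      (φ.toFormula.relabel (finSumFinEquiv : Fin k ⊕ Fin n → Fin (k + n))).Realize
        (Fin.append w zs) ↔ φ.Realize w zs := by
    intro w zs
    rw [Formula.realize_relabel, BoundedFormula.realize_toFormula]
    have h1 : (Fin.append w zs ∘ ⇑finSumFinEquiv) ∘ Sum.inl = w := by
      funext i; simp
    have h2 : (Fin.append w zs ∘ ⇑finSumFinEquiv) ∘ Sum.inr = zs := by
      funext i; simp
    rw [h1, h2]
  rw [← key v xs, ← key v' ys]
  refine h _ ?_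
  change BoundedFormula.IsAtomic (BoundedFormula.relabel _ _)
  refine BoundedFormula.IsAtomic.relabel ?_ _
  cases hφ with
  | equal t₁ t₂ => exact BoundedFormula.IsAtomic.equal _ _
  | rel R ts => exact BoundedFormula.IsAtomic.rel _ _

end EqQFType

/-! ### Karp's lemma for finite tuples -/

section Karp

variable {v v' : α → M}

/-- A family `S n ⊆ (Fin n → M)²` of pairs of finite tuples (over fixed parameter valuations
`v, v'`) is a **back-and-forth family** if related tuples satisfy the same atomic formulas and
every one-point extension on either side can be matched on the other side. (Declared in
Mathlib's namespace `FirstOrder.Language`, deliberately.) [folklore] -/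
structure IsBackAndForth (L : Language.{u, v}) {M : Type w} [L.Structure M] (v v' : α → M)
    (S : ∀ n : ℕ, (Fin n → M) → (Fin n → M) → Prop) : Prop where
  /-- Related tuples satisfy the same atomic formulas. -/
  atomic : ∀ {n} {xs ys : Fin n → M}, S n xs ys → ∀ φ : L.BoundedFormula α n, φ.IsAtomic →
    (φ.Realize v xs ↔ φ.Realize v' ys)
  /-- Forth. -/
  forth : ∀ {n} {xs ys : Fin n → M}, S n xs ys → ∀ a : M, ∃ b : M,
    S (n + 1) (Fin.snoc xs a) (Fin.snoc ys b)
  /-- Back. -/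
  back : ∀ {n} {xs ys : Fin n → M}, S n xs ys → ∀ b : M, ∃ a : M,
    S (n + 1) (Fin.snoc xs a) (Fin.snoc ys b)

/-- **Karp's lemma** (finite-tuple form): tuples related by a back-and-forth family satisfy the
same first-order formulas. [folklore] -/
theorem realize_iff_of_isBackAndForth {S : ∀ n : ℕ, (Fin n → M) → (Fin n → M) → Prop}
    (hS : L.IsBackAndForth v v' S) {n : ℕ} (φ : L.BoundedFormula α n) {xs ys : Fin n → M}
    (hxy : S n xs ys) : φ.Realize v xs ↔ φ.Realize v' ys := by
  induction φ with
  | falsum => exact Iff.rfl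
  | equal t₁ t₂ => exact hS.atomic hxy _ (BoundedFormula.IsAtomic.equal t₁ t₂)
  | rel R ts => exact hS.atomic hxy _ (BoundedFormula.IsAtomic.rel R ts)
  | imp f₁ f₂ ih₁ ih₂ =>
    rw [BoundedFormula.realize_imp, BoundedFormula.realize_imp]
    exact imp_congr (ih₁ hxy) (ih₂ hxy)
  | all f ih =>
    rw [BoundedFormula.realize_all, BoundedFormula.realize_all]
    constructor
    · intro h b
      obtain ⟨a, ha⟩ := hS.back hxy b
      exact (ih ha).1 (h a)
    · intro h a
      obtain ⟨b, hb⟩ := hS.forth hxy a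
      exact (ih hb).2 (h b)

end Karp

end FirstOrder.Language

namespace FirstOrder.Language

variable (L : Language.{u, v}) {M : Type w} [L.Structure M]

/-- **`qftp(H, t) = qftp(H', t')` along a matching `f`.** For `H ⊆ M`, a map `f : M → M`
(thought of as the bijection `H → H' := f '' H` given by matching enumerations of `H` and `H'`)
and finite tuples `t t'`, every finite tuple `σ` from `H` followed by `t` has the same
quantifier-free type as `f ∘ σ` followed by `t'`. With `t = t' = Fin.elim0` this is
"`H, H'` enumerated such that `qftp(H) = qftp(H')`" (Bays–Kirby 2018, Def. 6.1). A deliberate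
dot-notation extension in Mathlib's namespace `FirstOrder.Language`. [folklore] -/
def EqQFTypeOver (H : Set M) (f : M → M) {n : ℕ} (t t' : Fin n → M) : Prop :=
  ∀ ⦃m : ℕ⦄ (σ : Fin m → M), (∀ i, σ i ∈ H) →
    L.EqQFType (Fin.append σ t) (Fin.append (f ∘ σ) t')

variable {L}

/-- Over `H = ∅`, `qftp(H, t) = qftp(H', t')` is just `qftp(t) = qftp(t')`. [folklore] -/
theorem eqQFTypeOver_empty_iff {f : M → M} {n : ℕ} {t t' : Fin n → M} :
    L.EqQFTypeOver (∅ : Set M) f t t' ↔ L.EqQFType t t' := by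
  constructor
  · intro h
    have h0 := h (Fin.elim0 : Fin 0 → M) (fun i => i.elim0)
    have e1 : f ∘ (Fin.elim0 : Fin 0 → M) = Fin.elim0 := funext fun i => i.elim0
    rw [e1, Fin.elim0_append, Fin.elim0_append] at h0
    refine (h0.comp (Fin.cast (Nat.zero_add n).symm)).congr ?_ ?_ <;> funext i <;> simp
  · intro h m σ hσ
    rcases Nat.eq_zero_or_pos m with rfl | hm
    · have e0 : σ = Fin.elim0 := funext fun i => i.elim0
      subst e0
      have e1 : f ∘ (Fin.elim0 : Fin 0 → M) = Fin.elim0 := funext fun i => i.elim0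
      rw [e1, Fin.elim0_append, Fin.elim0_append]
      exact h.comp _
    · exact absurd (hσ ⟨0, hm⟩) (Set.notMem_empty _)

/-- `qftp(H, t) = qftp(H', t')` implies `qftp(t) = qftp(t')`. [folklore] -/
theorem EqQFTypeOver.eqQFType {H : Set M} {f : M → M} {n : ℕ} {t t' : Fin n → M}
    (h : L.EqQFTypeOver H f t t') : L.EqQFType t t' :=
  eqQFTypeOver_empty_iff.1 fun _ σ hσ => h σ fun i => absurd (hσ i) (Set.notMem_empty _)

/-- If every finite tuple from `H` has the same quantifier-free type as its `f`-image then
`qftp(H) = qftp(f[H])` in the sense of `EqQFTypeOver` (empty extra tuples). [folklore] -/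
theorem eqQFTypeOver_elim0 {H : Set M} {f : M → M}
    (h : ∀ ⦃m : ℕ⦄ (σ : Fin m → M), (∀ i, σ i ∈ H) → L.EqQFType σ (f ∘ σ)) :
    L.EqQFTypeOver H f (Fin.elim0 : Fin 0 → M) Fin.elim0 := by
  intro m σ hσ
  rw [Fin.append_elim0, Fin.append_elim0]
  exact (h σ hσ).comp _

/-- Conversely, `qftp(H) = qftp(f[H])` gives `qftp(σ) = qftp(f ∘ σ)` for tuples `σ` from `H`.
[folklore] -/
theorem EqQFTypeOver.of_elim0 {H : Set M} {f : M → M}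
    (h : L.EqQFTypeOver H f (Fin.elim0 : Fin 0 → M) Fin.elim0) {m : ℕ} (σ : Fin m → M)
    (hσ : ∀ i, σ i ∈ H) : L.EqQFType σ (f ∘ σ) := by
  have h0 := h σ hσ
  rw [Fin.append_elim0, Fin.append_elim0] at h0
  refine (h0.comp (Fin.cast (Nat.add_zero m).symm)).congr ?_ ?_ <;> funext i <;> simp

/-- From `qftp(H, [a]) = qftp(f[H], [a'])` and a tuple `σ` from `H`:
`qftp(σ, a) = qftp(f ∘ σ, a')`. [folklore] -/
theorem EqQFTypeOver.snoc {H : Set M} {f : M → M} {a a' : M}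
    (h : L.EqQFTypeOver H f ![a] ![a']) {m : ℕ} (σ : Fin m → M) (hσ : ∀ i, σ i ∈ H) :
    L.EqQFType (Fin.snoc σ a : Fin (m + 1) → M) (Fin.snoc (f ∘ σ) a') := by
  have := h σ hσ
  rwa [Fin.append_right_eq_snoc, Fin.append_right_eq_snoc, Matrix.cons_val_fin_one,
    Matrix.cons_val_fin_one] at this

end FirstOrder.Language

namespace Literature.ModelTheory.Quasiminimal

variable (L : Language.{u, v}) (M : Type w) [L.Structure M] (cl : Set M → Set M)

/-- **Weakly quasiminimal pregeometry structures** (Bays–Hart–Hyttinen–Kesälä–Kirby 2014,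
Def. 2.1; Bays–Kirby 2018, Def. 6.1, axioms QM1, QM3, QM4, QM5). An `L`-structure `M` with a
pregeometry `cl` such that:

* (QM1) the pregeometry is determined by the language: if `qftp(b, a) = qftp(b', a')` and
  `a ∈ cl(b)` then `a' ∈ cl(b')`;
* (QM3) countable closure property: `cl A` is countable for finite `A`;
* (QM4) uniqueness of the generic type: if `H, H'` are countable closed subsets enumerated so
  that `qftp(H) = qftp(H')` (here: matched by `f`, `H' = f '' H`), `a ∉ H`, `a' ∉ H'`, then
  `qftp(H, a) = qftp(H', a')`;
* (QM5) `ℵ₀`-homogeneity over closed sets and `∅`: if `H, H'` are countable closed subsets or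
  empty with `qftp(H, b) = qftp(H', b')` and `a ∈ cl(H ∪ b)` then there is `a'` with
  `qftp(H, b, a) = qftp(H', b', a')`.

(QM2, infinite-dimensionality, is added in `IsQuasiminimalPregeometryStructure`.) The source
assumes `L` countable; this is not needed for the results below and not recorded — named facts
using this predicate as a hypothesis must add `Countable L.Symbols`.

*Rendering of "enumerated such that `qftp(H) = qftp(H')`".* Matching enumerations `h, h'` of
`H, H'` with `qftp(h) = qftp(h')` determine a bijection `H → H'`, `h i ↦ h' i` (well defined
since equalities `hᵢ = hⱼ` are atomic formulas), every finite sub-tuple of which preserves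
quantifier-free types; conversely such a map `f` gives matching enumerations `h`, `f ∘ h`, since
a quantifier-free formula involves finitely many variables. So QM4/QM5 below quantify over
`H` and `f : M → M` (`H' = f '' H`) subject to `EqQFTypeOver`.
[cite: BHHKK2014, Def. 2.1] [cite: BaysKirby2018ANT, Def. 6.1] -/
structure IsWeaklyQuasiminimalPregeometryStructure : Prop where
  /-- `cl` is a pregeometry. -/
  isPregeometry : IsPregeometry cl
  /-- (QM1) The pregeometry is determined by quantifier-free types. -/
  mem_cl_of_eqQFType : ∀ ⦃n : ℕ⦄ (b b' : Fin n → M) (a a' : M),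
    L.EqQFType (Fin.snoc b a : Fin (n + 1) → M) (Fin.snoc b' a') →
      a ∈ cl (Set.range b) → a' ∈ cl (Set.range b')
  /-- (QM3) Countable closure property. -/
  countable_cl : ∀ A : Set M, A.Finite → (cl A).Countable
  /-- (QM4) Uniqueness of the generic type over countable closed sets. -/
  uniqueness_of_generic_type : ∀ (H : Set M) (f : M → M), H.Countable → cl H = H →
    cl (f '' H) = f '' H → L.EqQFTypeOver H f (Fin.elim0 : Fin 0 → M) Fin.elim0 →
      ∀ ⦃a a' : M⦄, a ∉ H → a' ∉ f '' H → L.EqQFTypeOver H f ![a] ![a']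
  /-- (QM5) `ℵ₀`-homogeneity over countable closed sets and over `∅`. -/
  homogeneity_over_closed : ∀ (H : Set M) (f : M → M), H.Countable →
    (cl H = H ∧ cl (f '' H) = f '' H) ∨ H = ∅ →
      ∀ ⦃n : ℕ⦄ (b b' : Fin n → M), L.EqQFTypeOver H f b b' →
        ∀ ⦃a : M⦄, a ∈ cl (H ∪ Set.range b) →
          ∃ a' : M, L.EqQFTypeOver H f (Fin.snoc b a : Fin (n + 1) → M) (Fin.snoc b' a')

/-- **Quasiminimal pregeometry structures** (Bays–Hart–Hyttinen–Kesälä–Kirby 2014, Def. 2.1;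
Bays–Kirby 2018, Def. 6.1): a weakly quasiminimal pregeometry structure which is moreover
(QM2) infinite dimensional — no finite set spans `M`.
[cite: BHHKK2014, Def. 2.1] [cite: BaysKirby2018ANT, Def. 6.1] -/
structure IsQuasiminimalPregeometryStructure : Prop
    extends IsWeaklyQuasiminimalPregeometryStructure L M cl where
  /-- (QM2) `M` is infinite dimensional with respect to `cl`. -/
  cl_ne_univ : ∀ A : Set M, A.Finite → cl A ≠ Set.univ

namespace IsWeaklyQuasiminimalPregeometryStructure

variable {L M cl}

/-- Extending a tuple stored as an `ℕ`-sequence: the first `k + 1` values of the sequence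
updated at `k` form the `Fin.snoc` of the first `k` values. [folklore] -/
theorem tuple_update_eq_snoc (x : ℕ → M) (k : ℕ) (a : M) :
    (fun i : Fin (k + 1) => if (i : ℕ) = k then a else x i) =
      (Fin.snoc (fun i : Fin k => x i) a : Fin (k + 1) → M) := by
  funext i
  refine Fin.lastCases ?_ (fun j => ?_) i
  · simp
  · have hj : (j : ℕ) ≠ k := Nat.ne_of_lt j.isLt
    simp [Fin.snoc_castSucc, hj]

/-- One step of the back-and-forth inside closures: QM5 over `∅` extends `qftp(t) = qftp(t')`
to any `a ∈ cl(t)`, and by QM1 the matching element lies in `cl(t')`.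
[cite: BHHKK2014, Lemma 2.2 (proof)] -/
theorem exists_snoc_of_mem_cl (h : IsWeaklyQuasiminimalPregeometryStructure L M cl) {k : ℕ}
    {t t' : Fin k → M} (htt' : L.EqQFType t t') {a : M} (ha : a ∈ cl (Set.range t)) :
    ∃ a' : M, L.EqQFType (Fin.snoc t a : Fin (k + 1) → M) (Fin.snoc t' a') ∧
      a' ∈ cl (Set.range t') := by
  obtain ⟨a', ha'⟩ := h.homogeneity_over_closed ∅ id Set.countable_empty (Or.inr rfl) t t'
    (eqQFTypeOver_empty_iff.2 htt') (a := a) (by rwa [Set.empty_union])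
  have key : L.EqQFType (Fin.snoc t a : Fin (k + 1) → M) (Fin.snoc t' a') :=
    eqQFTypeOver_empty_iff.1 ha'
  exact ⟨a', key, h.mem_cl_of_eqQFType t t' a a' key ha⟩

/-- **Back-and-forth inside countable closures.** In a weakly quasiminimal pregeometry
structure, if `qftp(b) = qftp(b')` then there is a map `f` with `f ∘ b = b'`, carrying
`cl(b)` onto `cl(b')`, such that every finite tuple from `cl(b)` has the same quantifier-free
type as its image ("the standard back-and-forth argument", Bays–Kirby 2018, proof of Prop. 6.5;
Bays–Hart–Hyttinen–Kesälä–Kirby 2014 §3, "back-and-forth arguments").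
[cite: BHHKK2014, §3] [cite: BaysKirby2018ANT, Prop. 6.5 (proof)] -/
theorem exists_closureIso (h : IsWeaklyQuasiminimalPregeometryStructure L M cl) {n : ℕ}
    {b b' : Fin n → M} (hbb' : L.EqQFType b b') :
    ∃ f : M → M, (∀ i, f (b i) = b' i) ∧ f '' cl (Set.range b) = cl (Set.range b') ∧
      ∀ ⦃m : ℕ⦄ (σ : Fin m → M), (∀ i, σ i ∈ cl (Set.range b)) → L.EqQFType σ (f ∘ σ) := by
  classical
  set C := cl (Set.range b) with hC
  set C' := cl (Set.range b') with hC'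
  have hP := h.isPregeometry
  have hCcl : cl C = C := hP.cl_cl _
  have hC'cl : cl C' = C' := hP.cl_cl _
  -- The degenerate case `C = ∅`.
  by_cases hCe : C = ∅
  · have hbe : IsEmpty (Fin n) := ⟨fun i => by
      have : b i ∈ C := hP.subset_cl _ (Set.mem_range_self i)
      rw [hCe] at this
      exact this⟩
    have hrb : Set.range b = ∅ := Set.range_eq_empty b
    have hrb' : Set.range b' = ∅ := Set.range_eq_empty b'
    refine ⟨id, fun i => (hbe.false i).elim, ?_, fun m σ _ => EqQFType.refl σ⟩
    rw [Set.image_id, hC, hC', hrb, hrb']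
  -- Enumerate `C` and `C'`.
  have hCne : C.Nonempty := Set.nonempty_iff_ne_empty.2 hCe
  have hC'ne : C'.Nonempty := by
    cases isEmpty_or_nonempty (Fin n) with
    | inl _ =>
      have : C' = C := by rw [hC, hC', Set.range_eq_empty b, Set.range_eq_empty b']
      rw [this]; exact hCne
    | inr hne =>
      obtain ⟨i⟩ := hne
      exact ⟨b' i, hP.subset_cl _ (Set.mem_range_self i)⟩
  have hCcount : C.Countable := hP.countable_cl h.countable_cl (Set.countable_range b)
  have hC'count : C'.Countable := hP.countable_cl h.countable_cl (Set.countable_range b')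
  obtain ⟨e, he⟩ := hCcount.exists_eq_range hCne
  obtain ⟨e', he'⟩ := hC'count.exists_eq_range hC'ne
  -- States of the construction: a length and two sequences.
  let tup : ℕ × (ℕ → M) × (ℕ → M) → (k : ℕ) → (Fin k → M) × (Fin k → M) :=
    fun s k => (fun i => s.2.1 i, fun i => s.2.2 i)
  let s₀ : ℕ × (ℕ → M) × (ℕ → M) :=
    (n, fun i => if hi : i < n then b ⟨i, hi⟩ else e 0, fun i => if hi : i < n then b' ⟨i, hi⟩ else e 0)
  let Ext : (ℕ × (ℕ → M) × (ℕ → M)) → (ℕ × (ℕ → M) × (ℕ → M)) → Prop := fun s s' =>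
    s.1 ≤ s'.1 ∧ ∀ i < s.1, s'.2.1 i = s.2.1 i ∧ s'.2.2 i = s.2.2 i
  let Good : (ℕ × (ℕ → M) × (ℕ → M)) → Prop := fun s =>
    Ext s₀ s ∧ L.EqQFType (tup s s.1).1 (tup s s.1).2 ∧
      (∀ i < s.1, s.2.1 i ∈ C) ∧ (∀ i < s.1, s.2.2 i ∈ C')
  have hExt_refl : ∀ s, Ext s s := fun s => ⟨le_rfl, fun i _ => ⟨rfl, rfl⟩⟩
  have hExt_trans : ∀ s s' s'', Ext s s' → Ext s' s'' → Ext s s'' := by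
    rintro s s' s'' ⟨h1, h1'⟩ ⟨h2, h2'⟩
    refine ⟨h1.trans h2, fun i hi => ?_⟩
    obtain ⟨ha, hb⟩ := h1' i hi
    obtain ⟨ha', hb'⟩ := h2' i (lt_of_lt_of_le hi h1)
    exact ⟨ha'.trans ha, hb'.trans hb⟩
  have hs₀b : (tup s₀ n).1 = b := by
    funext i; simp [tup, s₀, i.isLt]
  have hs₀b' : (tup s₀ n).2 = b' := by
    funext i; simp [tup, s₀, i.isLt]
  have hGood₀ : Good s₀ := by
    refine ⟨hExt_refl _, ?_, ?_, ?_⟩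
    · change L.EqQFType (tup s₀ n).1 (tup s₀ n).2
      rw [hs₀b, hs₀b']; exact hbb'
    · intro i hi
      change (if hi : i < n then b ⟨i, hi⟩ else e 0) ∈ C
      rw [dif_pos hi]; exact hP.subset_cl _ (Set.mem_range_self _)
    · intro i hi
      change (if hi : i < n then b' ⟨i, hi⟩ else e 0) ∈ C'
      rw [dif_pos hi]; exact hP.subset_cl _ (Set.mem_range_self _)
  -- ranges of good states
  have hrange : ∀ s, Good s → Set.range b ⊆ Set.range (tup s s.1).1 ∧
      Set.range b' ⊆ Set.range (tup s s.1).2 ∧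
      Set.range (tup s s.1).1 ⊆ C ∧ Set.range (tup s s.1).2 ⊆ C' := by
    rintro s ⟨⟨hle, hext⟩, -, h1, h2⟩
    refine ⟨?_, ?_, ?_, ?_⟩
    · rintro _ ⟨i, rfl⟩
      refine ⟨⟨i, lt_of_lt_of_le i.isLt hle⟩, ?_⟩
      have := (hext i i.isLt).1
      simp only [s₀, dif_pos i.isLt] at this
      exact this
    · rintro _ ⟨i, rfl⟩
      refine ⟨⟨i, lt_of_lt_of_le i.isLt hle⟩, ?_⟩
      have := (hext i i.isLt).2
      simp only [s₀, dif_pos i.isLt] at this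
      exact this
    · rintro _ ⟨i, rfl⟩; exact h1 i i.isLt
    · rintro _ ⟨i, rfl⟩; exact h2 i i.isLt
  -- forth step
  have hforth : ∀ s, Good s → ∀ a ∈ C, ∃ s', Good s' ∧ Ext s s' ∧ s'.1 = s.1 + 1 ∧
      s'.2.1 s.1 = a := by
    intro s hs a ha
    obtain ⟨hb, -, h1, h2⟩ := hrange s hs
    obtain ⟨hs0, htt', hm1, hm2⟩ := hs
    have ha' : a ∈ cl (Set.range (tup s s.1).1) := hP.mono hb ha
    obtain ⟨a', hqf, ha'C⟩ := h.exists_snoc_of_mem_cl htt' ha'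
    let s' : ℕ × (ℕ → M) × (ℕ → M) :=
      (s.1 + 1, fun i => if i = s.1 then a else s.2.1 i, fun i => if i = s.1 then a' else s.2.2 i)
    have hext : Ext s s' := ⟨Nat.le_succ _, fun i hi =>
      ⟨(if_neg (Nat.ne_of_lt hi) : (if i = s.1 then a else s.2.1 i) = s.2.1 i),
        (if_neg (Nat.ne_of_lt hi) : (if i = s.1 then a' else s.2.2 i) = s.2.2 i)⟩⟩
    refine ⟨s', ⟨hExt_trans _ _ _ hs0 hext, ?_, ?_, ?_⟩, hext, rfl, by simp [s']⟩
    · change L.EqQFType (fun i : Fin (s.1 + 1) => if (i : ℕ) = s.1 then a else s.2.1 i)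
        (fun i : Fin (s.1 + 1) => if (i : ℕ) = s.1 then a' else s.2.2 i)
      rw [tuple_update_eq_snoc, tuple_update_eq_snoc]
      exact hqf
    · intro i hi
      change (if i = s.1 then a else s.2.1 i) ∈ C
      split_ifs with hi'
      · exact ha
      · have hi2 : i < s.1 + 1 := hi
        exact hm1 i (by omega)
    · intro i hi
      change (if i = s.1 then a' else s.2.2 i) ∈ C'
      split_ifs with hi'
      · exact hP.cl_subset_of_subset h2 hC'cl ha'C
      · have hi2 : i < s.1 + 1 := hi
        exact hm2 i (by omega)
  -- back step
  have hback : ∀ s, Good s → ∀ a' ∈ C', ∃ s', Good s' ∧ Ext s s' ∧ s'.1 = s.1 + 1 ∧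
      s'.2.2 s.1 = a' := by
    intro s hs a' ha'
    obtain ⟨-, hb', h1, h2⟩ := hrange s hs
    obtain ⟨hs0, htt', hm1, hm2⟩ := hs
    have ha'' : a' ∈ cl (Set.range (tup s s.1).2) := hP.mono hb' ha'
    obtain ⟨a, hqf, haC⟩ := h.exists_snoc_of_mem_cl htt'.symm ha''
    let s' : ℕ × (ℕ → M) × (ℕ → M) :=
      (s.1 + 1, fun i => if i = s.1 then a else s.2.1 i, fun i => if i = s.1 then a' else s.2.2 i)
    have hext : Ext s s' := ⟨Nat.le_succ _, fun i hi =>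
      ⟨(if_neg (Nat.ne_of_lt hi) : (if i = s.1 then a else s.2.1 i) = s.2.1 i),
        (if_neg (Nat.ne_of_lt hi) : (if i = s.1 then a' else s.2.2 i) = s.2.2 i)⟩⟩
    refine ⟨s', ⟨hExt_trans _ _ _ hs0 hext, ?_, ?_, ?_⟩, hext, rfl, by simp [s']⟩
    · change L.EqQFType (fun i : Fin (s.1 + 1) => if (i : ℕ) = s.1 then a else s.2.1 i)
        (fun i : Fin (s.1 + 1) => if (i : ℕ) = s.1 then a' else s.2.2 i)
      rw [tuple_update_eq_snoc, tuple_update_eq_snoc]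
      exact hqf.symm
    · intro i hi
      change (if i = s.1 then a else s.2.1 i) ∈ C
      split_ifs with hi'
      · exact hP.cl_subset_of_subset h1 hCcl haC
      · have hi2 : i < s.1 + 1 := hi
        exact hm1 i (by omega)
    · intro i hi
      change (if i = s.1 then a' else s.2.2 i) ∈ C'
      split_ifs with hi'
      · exact ha'
      · have hi2 : i < s.1 + 1 := hi
        exact hm2 i (by omega)
  -- combined step `j`: add `e j` on the left and `e' j` on the right
  have hstep : ∀ s, Good s → ∀ j : ℕ, ∃ s', Good s' ∧ Ext s s' ∧
      (∃ i < s'.1, s'.2.1 i = e j) ∧ (∃ i < s'.1, s'.2.2 i = e' j) := by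
    intro s hs j
    obtain ⟨s₁, hs₁, hext₁, hlen₁, hval₁⟩ := hforth s hs (e j) (he ▸ Set.mem_range_self j)
    obtain ⟨s₂, hs₂, hext₂, hlen₂, hval₂⟩ := hback s₁ hs₁ (e' j) (he' ▸ Set.mem_range_self j)
    refine ⟨s₂, hs₂, hExt_trans _ _ _ hext₁ hext₂, ⟨s.1, by omega, ?_⟩, ⟨s₁.1, by omega, hval₂⟩⟩
    rw [(hext₂.2 s.1 (by omega)).1, hval₁]
  choose! F hF using hstep
  let seq : ℕ → ℕ × (ℕ → M) × (ℕ → M) := fun j => Nat.rec s₀ (fun j s => F s j) j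
  have hseq_succ : ∀ j, seq (j + 1) = F (seq j) j := fun j => rfl
  have hGood : ∀ j, Good (seq j) := by
    intro j
    induction j with
    | zero => exact hGood₀
    | succ j ih => rw [hseq_succ]; exact (hF _ ih j).1
  have hExt_succ : ∀ j, Ext (seq j) (seq (j + 1)) := fun j => by
    rw [hseq_succ]; exact (hF _ (hGood j) j).2.1
  have hExt_le : ∀ {j j'}, j ≤ j' → Ext (seq j) (seq j') := by
    intro j j' hjj'
    induction hjj' with
    | refl => exact hExt_refl _
    | step _ ih => exact hExt_trans _ _ _ ih (hExt_succ _)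
  -- the graph of the limit map
  let R : M → M → Prop := fun m m' => ∃ j, ∃ i < (seq j).1, (seq j).2.1 i = m ∧ (seq j).2.2 i = m'
  have hR_stage : ∀ {m m'}, R m m' → ∀ J, (∀ j, (∃ i < (seq j).1, (seq j).2.1 i = m ∧
      (seq j).2.2 i = m') → ∃ i < (seq (max j J)).1, (seq (max j J)).2.1 i = m ∧
        (seq (max j J)).2.2 i = m') := by
    rintro m m' - J j ⟨i, hi, h1, h2⟩
    obtain ⟨hle, hext⟩ := hExt_le (le_max_left j J)
    exact ⟨i, lt_of_lt_of_le hi hle, (hext i hi).1.trans h1, (hext i hi).2.trans h2⟩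
  have hR_lift : ∀ {m m' j J}, j ≤ J → (∃ i < (seq j).1, (seq j).2.1 i = m ∧ (seq j).2.2 i = m') →
      ∃ i < (seq J).1, (seq J).2.1 i = m ∧ (seq J).2.2 i = m' := by
    rintro m m' j J hjJ ⟨i, hi, h1, h2⟩
    obtain ⟨hle, hext⟩ := hExt_le hjJ
    exact ⟨i, lt_of_lt_of_le hi hle, (hext i hi).1.trans h1, (hext i hi).2.trans h2⟩
  have hR_fun : ∀ {m m₁ m₂}, R m m₁ → R m m₂ → m₁ = m₂ := by
    rintro m m₁ m₂ ⟨j₁, hj₁⟩ ⟨j₂, hj₂⟩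
    obtain ⟨i₁, hi₁, h₁, h₁'⟩ := hR_lift (le_max_left j₁ j₂) hj₁
    obtain ⟨i₂, hi₂, h₂, h₂'⟩ := hR_lift (le_max_right j₁ j₂) hj₂
    obtain ⟨-, hqf, -, -⟩ := hGood (max j₁ j₂)
    have := (hqf.apply_eq_iff ⟨i₁, hi₁⟩ ⟨i₂, hi₂⟩).1 (h₁.trans h₂.symm)
    rw [← h₁', ← h₂']
    exact this
  have hR_inj : ∀ {m₁ m₂ m'}, R m₁ m' → R m₂ m' → m₁ = m₂ := by
    rintro m₁ m₂ m' ⟨j₁, hj₁⟩ ⟨j₂, hj₂⟩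
    obtain ⟨i₁, hi₁, h₁, h₁'⟩ := hR_lift (le_max_left j₁ j₂) hj₁
    obtain ⟨i₂, hi₂, h₂, h₂'⟩ := hR_lift (le_max_right j₁ j₂) hj₂
    obtain ⟨-, hqf, -, -⟩ := hGood (max j₁ j₂)
    have := (hqf.apply_eq_iff ⟨i₁, hi₁⟩ ⟨i₂, hi₂⟩).2 (h₁'.trans h₂'.symm)
    rw [← h₁, ← h₂]
    exact this
  have hR_mem : ∀ {m m'}, R m m' → m ∈ C ∧ m' ∈ C' := by
    rintro m m' ⟨j, i, hi, rfl, rfl⟩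
    obtain ⟨-, -, h1, h2⟩ := hGood j
    exact ⟨h1 i hi, h2 i hi⟩
  have hR_dom : ∀ m ∈ C, ∃ m', R m m' := by
    intro m hm
    rw [he] at hm
    obtain ⟨j, rfl⟩ := hm
    obtain ⟨-, -, ⟨i, hi, hval⟩, -⟩ := hF _ (hGood j) j
    exact ⟨(seq (j + 1)).2.2 i, j + 1, i, hi, hval, rfl⟩
  have hR_ran : ∀ m' ∈ C', ∃ m, R m m' := by
    intro m' hm'
    rw [he'] at hm'
    obtain ⟨j, rfl⟩ := hm'
    obtain ⟨-, -, -, ⟨i, hi, hval⟩⟩ := hF _ (hGood j) j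
    exact ⟨(seq (j + 1)).2.1 i, j + 1, i, hi, rfl, hval⟩
  have hR_b : ∀ i : Fin n, R (b i) (b' i) := fun i =>
    ⟨0, i, i.isLt, by simp [seq, s₀, i.isLt], by simp [seq, s₀, i.isLt]⟩
  -- the limit map
  let f : M → M := fun m => if hm : ∃ m', R m m' then hm.choose else m
  have hf : ∀ {m m'}, R m m' → f m = m' := by
    intro m m' hmm'
    have hex : ∃ m', R m m' := ⟨m', hmm'⟩
    simp only [f, dif_pos hex]
    exact hR_fun hex.choose_spec hmm'
  have hfR : ∀ m ∈ C, R m (f m) := by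
    intro m hm
    obtain ⟨m', hmm'⟩ := hR_dom m hm
    rwa [hf hmm']
  refine ⟨f, fun i => hf (hR_b i), ?_, ?_⟩
  · apply Set.Subset.antisymm
    · rintro _ ⟨m, hm, rfl⟩
      exact (hR_mem (hfR m hm)).2
    · intro m' hm'
      obtain ⟨m, hmm'⟩ := hR_ran m' hm'
      exact ⟨m, (hR_mem hmm').1, hf hmm'⟩
  · intro m σ hσ
    have : ∀ i, ∃ j, ∃ p < (seq j).1, (seq j).2.1 p = σ i ∧ (seq j).2.2 p = f (σ i) :=
      fun i => hfR (σ i) (hσ i)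
    choose j p hp hpσ hpf using this
    obtain ⟨J, hJ⟩ : ∃ J, ∀ i, j i ≤ J :=
      ⟨Finset.univ.sup j, fun i => Finset.le_sup (Finset.mem_univ i)⟩
    obtain ⟨-, hqf, -, -⟩ := hGood J
    have hpJ : ∀ i, p i < (seq J).1 := fun i => lt_of_lt_of_le (hp i) (hExt_le (hJ i)).1
    let π : Fin m → Fin (seq J).1 := fun i => ⟨p i, hpJ i⟩
    have h1 : σ = (tup (seq J) (seq J).1).1 ∘ π := by
      funext i
      simp only [Function.comp_apply, tup, π]
      rw [((hExt_le (hJ i)).2 (p i) (hp i)).1, hpσ]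
    have h2 : f ∘ σ = (tup (seq J) (seq J).1).2 ∘ π := by
      funext i
      simp only [Function.comp_apply, tup, π]
      rw [((hExt_le (hJ i)).2 (p i) (hp i)).2, hpf]
    rw [h2, h1]
    exact hqf.comp π

end IsWeaklyQuasiminimalPregeometryStructure

end Literature.ModelTheory.Quasiminimal

namespace Literature.ModelTheory.Quasiminimal.IsWeaklyQuasiminimalPregeometryStructure

variable {L : Language.{u, v}} {M : Type w} [L.Structure M] {cl : Set M → Set M}

/-- **`ℵ₀`-homogeneity over `∅`** (Bays–Hart–Hyttinen–Kesälä–Kirby 2014, Lemma 2.2; Bays–Kirby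
2018, Prop. 6.5, QM5a). In an uncountable weakly quasiminimal pregeometry structure, if
`qftp(b) = qftp(b')` then for every `a` there is `a'` with `qftp(b, a) = qftp(b', a')`: for
`a ∈ cl(b)` this is QM5 over `∅`; otherwise transport `cl(b)` onto `cl(b')` by
`exists_closureIso`, pick `a' ∉ cl(b')` (countable closure property, `M` uncountable) and apply
QM4. The printed lemma has no uncountability hypothesis (it finds `a' ∉ cl(b')` by a dimension
count instead); this is its uncountable case. [cite: BHHKK2014, Lemma 2.2 (uncountable case)] -/
theorem homogeneity [Uncountable M] (h : IsWeaklyQuasiminimalPregeometryStructure L M cl)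
    {n : ℕ} {b b' : Fin n → M} (hbb' : L.EqQFType b b') (a : M) :
    ∃ a' : M, L.EqQFType (Fin.snoc b a : Fin (n + 1) → M) (Fin.snoc b' a') := by
  have hP := h.isPregeometry
  by_cases ha : a ∈ cl (Set.range b)
  · obtain ⟨a', ha', -⟩ := h.exists_snoc_of_mem_cl hbb' ha
    exact ⟨a', ha'⟩
  · obtain ⟨f, hfb, hfC, hf⟩ := h.exists_closureIso hbb'
    obtain ⟨a', ha'⟩ := hP.exists_notMem_cl h.countable_cl (Set.countable_range b')
    have hCcount : (cl (Set.range b)).Countable :=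
      hP.countable_cl h.countable_cl (Set.countable_range b)
    have hclosed' : cl (f '' cl (Set.range b)) = f '' cl (Set.range b) := by
      rw [hfC]; exact hP.cl_cl _
    have key := h.uniqueness_of_generic_type (cl (Set.range b)) f hCcount (hP.cl_cl _) hclosed'
      (eqQFTypeOver_elim0 hf) ha (by rwa [hfC])
    have := key.snoc b fun i => hP.subset_cl _ (Set.mem_range_self i)
    have hfb' : f ∘ b = b' := funext hfb
    rw [hfb'] at this
    exact ⟨a', this⟩

/-- In an uncountable weakly quasiminimal pregeometry structure, finite tuples with the same
quantifier-free type over a common parameter tuple satisfy the same first-order formulas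
(Bays–Hart–Hyttinen–Kesälä–Kirby 2014, §2, first paragraph; Bays–Kirby 2018, Remark 6.6), by
Karp's lemma applied to the back-and-forth family given by `homogeneity`.
[cite: BHHKK2014, §2] [cite: BaysKirby2018ANT, Remark 6.6] -/
theorem realize_iff_of_eqQFType [Uncountable M] (h : IsWeaklyQuasiminimalPregeometryStructure L M cl)
    {k n : ℕ} {v v' : Fin k → M} {xs ys : Fin n → M}
    (hqf : L.EqQFType (Fin.append v xs) (Fin.append v' ys)) (φ : L.BoundedFormula (Fin k) n) :
    φ.Realize v xs ↔ φ.Realize v' ys := by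
  have hS : L.IsBackAndForth v v'
      (fun n (xs ys : Fin n → M) => L.EqQFType (Fin.append v xs) (Fin.append v' ys)) := by
    refine ⟨fun hxy φ hφ => hxy.realize_bd_iff hφ, fun {n xs ys} hxy a => ?_,
      fun {n xs ys} hxy b => ?_⟩
    · obtain ⟨a', ha'⟩ := h.homogeneity hxy a
      refine ⟨a', ?_⟩
      rwa [Fin.append_snoc, Fin.append_snoc]
    · obtain ⟨a, ha⟩ := h.homogeneity hxy.symm b
      refine ⟨a, ?_⟩
      rw [Fin.append_snoc, Fin.append_snoc]
      exact ha.symm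
  exact realize_iff_of_isBackAndForth hS φ hqf

/-- Special case of `realize_iff_of_eqQFType` without extra variables: `qftp(v) = qftp(v')`
implies that `v` and `v'` satisfy the same first-order formulas.
[cite: BHHKK2014, §2] -/
theorem formula_realize_iff_of_eqQFType [Uncountable M]
    (h : IsWeaklyQuasiminimalPregeometryStructure L M cl) {k : ℕ} {v v' : Fin k → M}
    (hqf : L.EqQFType v v') (φ : L.Formula (Fin k)) : φ.Realize v ↔ φ.Realize v' := by
  have : L.EqQFType (Fin.append v Fin.elim0) (Fin.append v' Fin.elim0) := by
    rw [Fin.append_elim0, Fin.append_elim0]; exact hqf.comp _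
  exact h.realize_iff_of_eqQFType this φ

/-- **Weakly quasiminimal pregeometry structures are quasiminimal** (Bays–Hart–Hyttinen–
Kesälä–Kirby 2014, Prop. 7.1, second part; the step "`F ∈ 𝒦(M_tr(K))` and hence is
quasiminimal" of Bays–Kirby 2018, proof of Thm 11.6 / Cor. 11.7, p. 38). If `M` is an
uncountable weakly quasiminimal pregeometry structure then every subset of `M` definable with
parameters is countable or co-countable: a definable set `S = φ(M, b)` uses finitely many
parameters `b`; `H = cl(b)` is countable and closed, so by QM4 all `a ∉ H` have the same
quantifier-free type over `b`, hence (Karp, `realize_iff_of_eqQFType`) the same first-order type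
over `b`; so either `S ⊆ H` or `M ∖ H ⊆ S`.
[cite: BHHKK2014, Prop. 7.1] [cite: BaysKirby2018ANT, Cor. 11.7 (proof, p. 38)] -/
theorem countable_or_countable_compl [Uncountable M]
    (h : IsWeaklyQuasiminimalPregeometryStructure L M cl) {S : Set M}
    (hS : (Set.univ : Set M).Definable₁ L S) : S.Countable ∨ Sᶜ.Countable := by
  classical
  have hP := h.isPregeometry
  -- finitely many parameters and a defining formula
  obtain ⟨A₀, -, hA₀⟩ := Set.definable_iff_finitely_definable.1 hS
  obtain ⟨φ, hφ⟩ := Set.definable_iff_exists_formula_sum.1 hA₀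
  -- enumerate the parameters
  set k := Fintype.card (A₀ : Set M) with hk
  let eA : (A₀ : Set M) ≃ Fin k := Fintype.equivFin _
  let b : Fin k → M := fun i => (eA.symm i : M)
  set H := cl (Set.range b) with hH
  have hHcount : H.Countable := hP.countable_cl h.countable_cl (Set.countable_range b)
  have hHcl : cl H = H := hP.cl_cl _
  -- membership in `S` in terms of `φ`
  have hmem : ∀ a : M, a ∈ S ↔ φ.Realize (Sum.elim ((↑) : ↥(A₀ : Set M) → M) ![a]) := by
    intro a
    have := Set.ext_iff.1 hφ ![a]
    simpa only [Set.mem_setOf_eq, Matrix.cons_val_fin_one] using this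
  -- reindex `φ` to a formula in the variables `Fin (k + 1)` = (parameters, point)
  let g : (A₀ : Set M) ⊕ Fin 1 → Fin (k + 1) := Sum.elim (Fin.castSucc ∘ eA) fun _ => Fin.last k
  have hg : ∀ a : M, (Fin.snoc b a : Fin (k + 1) → M) ∘ g =
      Sum.elim ((↑) : ↥(A₀ : Set M) → M) ![a] := by
    intro a
    funext x
    rcases x with x | x
    · simp [g, b]
    · simp [g]
  have hmem' : ∀ a : M, a ∈ S ↔ (φ.relabel g).Realize (Fin.snoc b a : Fin (k + 1) → M) := by
    intro a
    rw [hmem, Formula.realize_relabel, hg]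
  -- all points outside `H` behave alike
  have hgen : ∀ ⦃a c : M⦄, a ∉ H → c ∉ H → (a ∈ S ↔ c ∈ S) := by
    intro a c ha hc
    have himg : id '' H = H := Set.image_id H
    have key := h.uniqueness_of_generic_type H id hHcount hHcl (by rw [himg]; exact hHcl)
      (eqQFTypeOver_elim0 fun _ σ _ => EqQFType.refl σ) ha (by rwa [himg])
    have hqf : L.EqQFType (Fin.snoc b a : Fin (k + 1) → M) (Fin.snoc b c) :=
      key.snoc b fun i => hP.subset_cl _ (Set.mem_range_self i)
    rw [hmem' a, hmem' c]
    exact h.formula_realize_iff_of_eqQFType hqf _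
  by_cases hex : ∃ a ∈ S, a ∉ H
  · obtain ⟨a, haS, haH⟩ := hex
    refine Or.inr (hHcount.mono fun c hc => ?_)
    by_contra hcH
    exact hc ((hgen haH hcH).1 haS)
  · refine Or.inl (hHcount.mono fun a ha => ?_)
    by_contra haH
    exact hex ⟨a, ha, haH⟩

end Literature.ModelTheory.Quasiminimal.IsWeaklyQuasiminimalPregeometryStructure
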